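import Literature.Analysis.FluidPDE.Tao2016AveragedNS.RetunedFlow
import HarnessLib

/-!
# The negative-kick dud of the retuned delay circuit (Tao 2016, §5.5)

HONEST FRAMING (cell `pub-fluidc`): low prior, high value-of-information experiment on Tao's
machine paradigm; NOT a claim that NS blows up.

Tao's delay gate fires because the seed pump `a → c` (rate `ε²e^{-M}`; Tao: `M = K¹⁰`) deposits a
positive pre-load on the swept trigger `c`, which the amplifier `ε⁻¹M·b·c` then blows up once the
clock `b ≈ εt` has run. The trigger equation `∂ₜc = ε²e^{-M}a² + ε⁻¹Mbc` is LINEAR in `c`: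
with the clock integral `G(t) = ∫₀ᵗ ε⁻¹Mb` the discounted trigger `c·e^{-G}` is non-decreasing and
`c(t) = e^{G(t)}(c(0) + ∫₀ᵗ ε²e^{-M}a²e^{-G})`. Hence a NEGATIVE pre-load `c(0) = -κ` competes with
the discounted seed integral, and by the intermediate value theorem some `κ*` makes `c(2) = 0`
exactly: along that EXACT trajectory the trigger is trapped in `[-3ε²e^{-M}, 0]` on the whole cycle
`[0,2]`, the rotor is never driven, and the output stays `≤ 6e^{-M}` — the gate does not fire on
its cycle (§4, `exists_negativeKick_dud`), from a datum within `3ε²e^{-M}` (three seeds) of (5.6).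

Set against the PROVED one-sided tolerance (`kickTransitionWith_from_two`: every pre-load
`0 ≤ κ ≤ ε²e^{-M}K¹⁰` fires on time), this exhibits the trigger channel of the gate as ASYMMETRIC
(§5, `trigger_channel_asymmetric`): `K¹⁰` seeds of positive pre-load are absorbed, fewer than three
seeds of negative pre-load stall the gate. No forcing is involved (defect `0`): the dud is a flow
line of the member itself, so it also bounds every datum-robustness radius of a firing guarantee by
three seeds (`datum_radius_lt_three_seeds`).

Technique: integrating factor for the linear trigger equation (as in the proof of Theorem 5.3 and in
`kickW_c_nonneg`), the a-priori bound `|c(t)| ≤ (κ + ε²e^{-M}t)e^{Mt²/2}` from `b ≤ εt` (no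
circularity), `b ≥ -50Mε³e^{2M}` from `∂ₜb ≥ -ε⁻¹Mc²`, continuity of the flow in the datum
(Grönwall, `IsPseudoOrbit.norm_sub_le`) and `intermediate_value_Icc'`.
-/

namespace Literature.Analysis.FluidPDE.Tao2016AveragedNS

open Real Set MeasureTheory
open scoped NNReal

namespace NegKick

variable {K M ε κ : ℝ} {X : ℝ → Fin 5 → ℝ}

/-! ## §1. The clock integral and the discounted trigger -/

/-- The clock integral `G(t) = ∫₀ᵗ ε⁻¹M·b` of a trajectory (the integrating factor of the linear
trigger equation is `e^{-G}`). [cite: Tao2016AveragedNS, §5.5 proof of Theorem 5.3] -/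
noncomputable def clockInt (ε M : ℝ) (X : ℝ → Fin 5 → ℝ) (t : ℝ) : ℝ :=
  ∫ r in (0 : ℝ)..t, ε⁻¹ * M * X r 1

/-- `G(0) = 0`. [folklore] -/
theorem clockInt_zero (ε M : ℝ) (X : ℝ → Fin 5 → ℝ) : clockInt ε M X 0 = 0 := by
  simp [clockInt]

/-- Trajectories are continuous, mode by mode. [folklore] -/
theorem continuous_traj (hX : ∀ t, HasDerivAt X (delayCircuitWith K M ε (X t)) t) (i : Fin 5) :
    Continuous fun t => X t i :=
  (continuous_apply i).comp (continuous_iff_continuousAt.2 fun t => (hX t).continuousAt)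

/-- `G' = ε⁻¹M·b`. [folklore] -/
theorem hasDerivAt_clockInt (hX : ∀ t, HasDerivAt X (delayCircuitWith K M ε (X t)) t) (t : ℝ) :
    HasDerivAt (clockInt ε M X) (ε⁻¹ * M * X t 1) t := by
  have hc : Continuous fun r => ε⁻¹ * M * X r 1 := continuous_const.mul (continuous_traj hX 1)
  show HasDerivAt (fun u => ∫ r in (0 : ℝ)..u, ε⁻¹ * M * X r 1) (ε⁻¹ * M * X t 1) t
  exact (hc.integral_hasStrictDerivAt 0 t).hasDerivAt

/-- **The discounted trigger is driven by the seed only**: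
`∂ₜ(c·e^{-G}) = ε²e^{-M}a²·e^{-G} ≥ 0`. [cite: Tao2016AveragedNS, §5.5 proof of Theorem 5.3] -/
theorem hasDerivAt_disc (hX : ∀ t, HasDerivAt X (delayCircuitWith K M ε (X t)) t) (t : ℝ) :
    HasDerivAt (fun s => X s 2 * exp (-clockInt ε M X s))
      (ε ^ 2 * exp (-M) * X t 0 ^ 2 * exp (-clockInt ε M X t)) t := by
  refine ((Thm53With.hasDerivAt_c hX t).fun_mul (hasDerivAt_clockInt hX t).fun_neg.exp).congr_deriv ?_
  ring

/-- The discounted drive is non-negative. [folklore] -/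
theorem disc_deriv_nonneg (X : ℝ → Fin 5 → ℝ) (t : ℝ) :
    0 ≤ ε ^ 2 * exp (-M) * X t 0 ^ 2 * exp (-clockInt ε M X t) := by positivity

/-- The discounted trigger `c·e^{-G}` is non-decreasing along every trajectory of every member.
[cite: Tao2016AveragedNS, §5.5 proof of Theorem 5.3] -/
theorem disc_monotone (hX : ∀ t, HasDerivAt X (delayCircuitWith K M ε (X t)) t) :
    Monotone fun s => X s 2 * exp (-clockInt ε M X s) := by
  refine monotone_of_deriv_nonneg (fun t => (hasDerivAt_disc hX t).differentiableAt) fun t => ?_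
  rw [(hasDerivAt_disc hX t).deriv]
  exact disc_deriv_nonneg X t

/-- The derivative of the discounted trigger is at most `ε²e^{-M}·e^{-G}` on an energy-one
trajectory (`a² ≤ 1`). [cite: Tao2016AveragedNS, §5.5] -/
theorem disc_deriv_le (hX : ∀ t, HasDerivAt X (delayCircuitWith K M ε (X t)) t)
    (h0 : X 0 = kickInit κ) (hκ : κ ^ 2 ≤ 1) (t : ℝ) :
    ε ^ 2 * exp (-M) * X t 0 ^ 2 * exp (-clockInt ε M X t) ≤
      ε ^ 2 * exp (-M) * exp (-clockInt ε M X t) := by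
  have ha : X t 0 ^ 2 ≤ 1 := kickW_sq_le_one hX h0 hκ t 0
  have h1 : 0 ≤ ε ^ 2 * exp (-M) * exp (-clockInt ε M X t) := by positivity
  nlinarith

/-! ## §2. A-priori bounds along a kicked trajectory (any pre-load `κ`, `κ² ≤ 1`) -/

/-- The clock runs at most like `Mt`: `t ↦ G(t) - Mt²/2` is non-increasing on `t ≥ 0`
(`b ≤ εt`, `kickW_b_le`). [cite: Tao2016AveragedNS, §5.5 (5.5) b-equation] -/
theorem clockGap_antitoneOn (hX : ∀ t, HasDerivAt X (delayCircuitWith K M ε (X t)) t)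
    (h0 : X 0 = kickInit κ) (hκ : κ ^ 2 ≤ 1) (hM : 0 ≤ M) (hε : 0 < ε) :
    AntitoneOn (fun t => clockInt ε M X t - M * t ^ 2 / 2) (Ici 0) := by
  refine Thm53.antitoneOn_sub_of_deriv_le (φ := fun t => M * t) (convex_Ici 0)
    (fun t _ => hasDerivAt_clockInt hX t)
    (fun t _ => by
      have := ((hasDerivAt_id t).pow 2).const_mul M |>.div_const 2
      refine this.congr_deriv ?_
      simp; ring)
    fun t ht => ?_
  have hb : X t 1 ≤ ε * t := kickW_b_le hX h0 hκ hM hε.le ht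
  calc ε⁻¹ * M * X t 1 = ε⁻¹ * M * X t 1 := rfl
    _ ≤ ε⁻¹ * M * (ε * t) := mul_le_mul_of_nonneg_left hb (by positivity)
    _ = M * t := by field_simp

/-- `G(t) ≤ Mt²/2` for `t ≥ 0`. [cite: Tao2016AveragedNS, §5.5] -/
theorem clockInt_le (hX : ∀ t, HasDerivAt X (delayCircuitWith K M ε (X t)) t)
    (h0 : X 0 = kickInit κ) (hκ : κ ^ 2 ≤ 1) (hM : 0 ≤ M) (hε : 0 < ε) {t : ℝ} (ht : 0 ≤ t) :
    clockInt ε M X t ≤ M * t ^ 2 / 2 := by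
  have h := clockGap_antitoneOn hX h0 hκ hM hε (self_mem_Ici (a := (0 : ℝ))) (mem_Ici.2 ht) ht
  simp only [clockInt_zero] at h
  linarith

/-- For `0 ≤ u ≤ t`: `G(t) - G(u) ≤ M(t² - u²)/2`. [cite: Tao2016AveragedNS, §5.5] -/
theorem clockInt_sub_le (hX : ∀ t, HasDerivAt X (delayCircuitWith K M ε (X t)) t)
    (h0 : X 0 = kickInit κ) (hκ : κ ^ 2 ≤ 1) (hM : 0 ≤ M) (hε : 0 < ε) {u t : ℝ} (hu : 0 ≤ u)
    (hut : u ≤ t) : clockInt ε M X t - clockInt ε M X u ≤ M * t ^ 2 / 2 - M * u ^ 2 / 2 := by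
  have h := clockGap_antitoneOn hX h0 hκ hM hε (mem_Ici.2 hu) (mem_Ici.2 (hu.trans hut)) hut
  simp only at h
  linarith

/-- **Lower a-priori bound**: `c(t) ≥ c(0)·e^{G(t)}`, hence for a NEGATIVE pre-load `c(0) = κ ≤ 0`:
`c(t) ≥ κ·e^{Mt²/2}` (`t ≥ 0`). [cite: Tao2016AveragedNS, §5.5 proof of Theorem 5.3] -/
theorem c_lower (hX : ∀ t, HasDerivAt X (delayCircuitWith K M ε (X t)) t)
    (h0 : X 0 = kickInit κ) (hκ : κ ^ 2 ≤ 1) (hκ0 : κ ≤ 0) (hM : 0 ≤ M) (hε : 0 < ε) {t : ℝ}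
    (ht : 0 ≤ t) : κ * exp (M * t ^ 2 / 2) ≤ X t 2 := by
  have hmono := disc_monotone hX ht
  simp only [clockInt_zero, neg_zero, exp_zero, mul_one, kick_init_c h0] at hmono
  -- hmono : κ ≤ X t 2 * exp (-G t)
  have hG : clockInt ε M X t ≤ M * t ^ 2 / 2 := clockInt_le hX h0 hκ hM hε ht
  have hpos : 0 < exp (-clockInt ε M X t) := exp_pos _
  have h1 : κ * exp (clockInt ε M X t) ≤ X t 2 := by
    have := mul_le_mul_of_nonneg_right hmono (exp_pos (clockInt ε M X t)).le
    rwa [mul_assoc, ← exp_add, neg_add_cancel, exp_zero, mul_one] at this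
  have h2 : κ * exp (M * t ^ 2 / 2) ≤ κ * exp (clockInt ε M X t) :=
    mul_le_mul_of_nonpos_left (exp_le_exp.2 hG) hκ0
  exact h2.trans h1

/-- **Upper a-priori bound**: `c(t) ≤ c(0)e^{G(t)} + ε²e^{-M}·t·e^{Mt²/2}`, hence for `κ ≤ 0`:
`c(t) ≤ ε²e^{-M}t·e^{Mt²/2}` (`t ≥ 0`): on `[0,t]` the discounted drive is at most
`ε²e^{-M}e^{-G(u)} ≤ ε²e^{-M}e^{-G(t) + Mt²/2}`. [cite: Tao2016AveragedNS, §5.5] -/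
theorem c_upper (hX : ∀ t, HasDerivAt X (delayCircuitWith K M ε (X t)) t)
    (h0 : X 0 = kickInit κ) (hκ : κ ^ 2 ≤ 1) (hκ0 : κ ≤ 0) (hM : 0 ≤ M) (hε : 0 < ε) {t : ℝ}
    (ht : 0 ≤ t) : X t 2 ≤ ε ^ 2 * exp (-M) * t * exp (M * t ^ 2 / 2) := by
  set k : ℝ := ε ^ 2 * exp (-M) * exp (-clockInt ε M X t + M * t ^ 2 / 2) with hk
  have hanti := Thm53.antitoneOn_sub_of_deriv_le (s := Icc 0 t)
    (f := fun s => X s 2 * exp (-clockInt ε M X s)) (φ := fun _ => k) (Φ := fun u => k * u)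
    (convex_Icc 0 t) (fun u _ => hasDerivAt_disc hX u)
    (fun u _ => by simpa using (hasDerivAt_id u).const_mul k) (fun u hu => by
      have h1 := disc_deriv_le hX h0 hκ u
      have hG : clockInt ε M X t - clockInt ε M X u ≤ M * t ^ 2 / 2 - M * u ^ 2 / 2 :=
        clockInt_sub_le hX h0 hκ hM hε hu.1 hu.2
      have h2 : exp (-clockInt ε M X u) ≤ exp (-clockInt ε M X t + M * t ^ 2 / 2) := by
        apply exp_le_exp.2
        nlinarith [sq_nonneg u]
      calc ε ^ 2 * exp (-M) * X u 0 ^ 2 * exp (-clockInt ε M X u)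
          ≤ ε ^ 2 * exp (-M) * exp (-clockInt ε M X u) := h1
        _ ≤ k := by rw [hk]; exact mul_le_mul_of_nonneg_left h2 (by positivity))
  have h := hanti (left_mem_Icc.2 ht) (right_mem_Icc.2 ht) ht
  simp only [clockInt_zero, neg_zero, exp_zero, mul_one, kick_init_c h0, mul_zero, sub_zero] at h
  -- h : X t 2 * exp (-G t) - k * t ≤ κ
  have hpos : 0 < exp (clockInt ε M X t) := exp_pos _
  have h3 : X t 2 = (X t 2 * exp (-clockInt ε M X t)) * exp (clockInt ε M X t) := by
    rw [mul_assoc, ← exp_add]; simp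
  have h4 : X t 2 * exp (-clockInt ε M X t) ≤ κ + k * t := by linarith
  have h5 : X t 2 ≤ (κ + k * t) * exp (clockInt ε M X t) := by
    rw [h3]; exact mul_le_mul_of_nonneg_right h4 hpos.le
  have h6 : (κ + k * t) * exp (clockInt ε M X t) ≤ k * t * exp (clockInt ε M X t) := by
    apply mul_le_mul_of_nonneg_right _ hpos.le
    linarith
  have h7 : k * t * exp (clockInt ε M X t) = ε ^ 2 * exp (-M) * t * exp (M * t ^ 2 / 2) := by
    rw [hk]
    have : exp (-clockInt ε M X t + M * t ^ 2 / 2) * exp (clockInt ε M X t) = exp (M * t ^ 2 / 2) := by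
      rw [← exp_add]; congr 1; ring
    calc ε ^ 2 * exp (-M) * exp (-clockInt ε M X t + M * t ^ 2 / 2) * t * exp (clockInt ε M X t)
        = ε ^ 2 * exp (-M) * t * (exp (-clockInt ε M X t + M * t ^ 2 / 2) * exp (clockInt ε M X t)) := by ring
      _ = _ := by rw [this]
  linarith [h5, h6, h7.le, h7.ge]

/-- **The a-priori trigger bound on the cycle**: for a negative pre-load `κ ∈ [-1, 0]` and
`t ∈ [0,2]`, `|c(t)| ≤ (-κ + 2ε²e^{-M})·e^{2M}`. [cite: Tao2016AveragedNS, §5.5] -/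
theorem abs_c_le (hX : ∀ t, HasDerivAt X (delayCircuitWith K M ε (X t)) t)
    (h0 : X 0 = kickInit κ) (hκ : κ ^ 2 ≤ 1) (hκ0 : κ ≤ 0) (hM : 0 ≤ M) (hε : 0 < ε) {t : ℝ}
    (ht : t ∈ Icc (0 : ℝ) 2) : |X t 2| ≤ (-κ + 2 * (ε ^ 2 * exp (-M))) * exp (2 * M) := by
  have hl := c_lower hX h0 hκ hκ0 hM hε ht.1
  have hu := c_upper hX h0 hκ hκ0 hM hε ht.1
  have he : exp (M * t ^ 2 / 2) ≤ exp (2 * M) := by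
    apply exp_le_exp.2
    have ht2 : t ^ 2 ≤ 4 := by nlinarith [ht.1, ht.2]
    have := mul_le_mul_of_nonneg_left ht2 hM
    linarith
  have he0 : 0 < exp (M * t ^ 2 / 2) := exp_pos _
  rw [abs_le]
  constructor
  · have : κ * exp (2 * M) ≤ κ * exp (M * t ^ 2 / 2) := mul_le_mul_of_nonpos_left he hκ0
    have h2 : 0 ≤ 2 * (ε ^ 2 * exp (-M)) * exp (2 * M) := by positivity
    nlinarith
  · have h1 : ε ^ 2 * exp (-M) * t * exp (M * t ^ 2 / 2) ≤ 2 * (ε ^ 2 * exp (-M)) * exp (2 * M) := by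
      have : ε ^ 2 * exp (-M) * t ≤ 2 * (ε ^ 2 * exp (-M)) := by nlinarith [ht.2, sq_nonneg ε, exp_pos (-M), mul_pos (pow_pos hε 2) (exp_pos (-M))]
      exact mul_le_mul this he he0.le (by positivity)
    have h2 : 0 ≤ -κ * exp (2 * M) := by nlinarith [exp_pos (2 * M)]
    nlinarith

/-- **The clock's floor**: if `|c| ≤ C` on `[0,τ]` then `b(t) ≥ -ε⁻¹MC²·t` there
(`∂ₜb = εa² - ε⁻¹Mc² ≥ -ε⁻¹MC²`). [cite: Tao2016AveragedNS, §5.5 (5.5) b-equation] -/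
theorem b_lower (hX : ∀ t, HasDerivAt X (delayCircuitWith K M ε (X t)) t)
    (h0 : X 0 = kickInit κ) (hM : 0 ≤ M) (hε : 0 < ε) {C τ : ℝ}
    (hC : ∀ u ∈ Icc 0 τ, |X u 2| ≤ C) {t : ℝ} (ht : t ∈ Icc 0 τ) :
    -(ε⁻¹ * M * C ^ 2) * t ≤ X t 1 := by
  have hmono := Thm53.monotoneOn_sub_of_le_deriv (s := Icc 0 τ) (f := fun s => X s 1)
    (φ := fun _ => -(ε⁻¹ * M * C ^ 2)) (Φ := fun u => -(ε⁻¹ * M * C ^ 2) * u) (convex_Icc 0 τ)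
    (fun u _ => (KickW.hasDerivAt_bcd hX u).1)
    (fun u _ => by simpa using (hasDerivAt_id u).const_mul (-(ε⁻¹ * M * C ^ 2)))
    (fun u hu => by
      have hc : X u 2 ^ 2 ≤ C ^ 2 := by
        have := hC u hu
        rw [← sq_abs]; exact pow_le_pow_left₀ (abs_nonneg _) this 2
      have h1 : 0 ≤ ε * X u 0 ^ 2 := by positivity
      have h2 : ε⁻¹ * M * X u 2 ^ 2 ≤ ε⁻¹ * M * C ^ 2 :=
        mul_le_mul_of_nonneg_left hc (by positivity)
      linarith)
  have h := hmono (left_mem_Icc.2 (ht.1.trans ht.2)) ht ht.1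
  simp only [kick_init_b h0, mul_zero, sub_zero] at h
  linarith

/-- If `b ≥ -β` on `[0,τ]` then `t ↦ G(t) + ε⁻¹Mβ·t` is non-decreasing there: the clock integral
loses at most `ε⁻¹Mβ` per unit time. [folklore] -/
theorem clockFloor_monotoneOn (hX : ∀ t, HasDerivAt X (delayCircuitWith K M ε (X t)) t)
    (hM : 0 ≤ M) (hε : 0 < ε) {β τ : ℝ} (hb : ∀ u ∈ Icc 0 τ, -β ≤ X u 1) :
    MonotoneOn (fun t => clockInt ε M X t + ε⁻¹ * M * β * t) (Icc 0 τ) := by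
  have h := Thm53.monotoneOn_sub_of_le_deriv (s := Icc 0 τ) (f := clockInt ε M X)
    (φ := fun _ => -(ε⁻¹ * M * β)) (Φ := fun u => -(ε⁻¹ * M * β) * u) (convex_Icc 0 τ)
    (fun u _ => hasDerivAt_clockInt hX u)
    (fun u _ => by simpa using (hasDerivAt_id u).const_mul (-(ε⁻¹ * M * β)))
    (fun u hu => by
      have := hb u hu
      have h1 : ε⁻¹ * M * (-β) ≤ ε⁻¹ * M * X u 1 := mul_le_mul_of_nonneg_left this (by positivity)
      linarith)
  intro u hu v hv huv
  have := h hu hv huv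
  simp only at this
  linarith

/-- **Endpoint bound (crude)**: with `b ≥ -β` on `[0,2]`,
`c(2)·e^{-G(2)} ≤ c(0) + 2ε²e^{-M}·e^{2ε⁻¹Mβ}`. [cite: Tao2016AveragedNS, §5.5] -/
theorem disc_two_le (hX : ∀ t, HasDerivAt X (delayCircuitWith K M ε (X t)) t)
    (h0 : X 0 = kickInit κ) (hκ : κ ^ 2 ≤ 1) (hM : 0 ≤ M) (hε : 0 < ε) {β : ℝ}
    (hb : ∀ u ∈ Icc (0 : ℝ) 2, -β ≤ X u 1) :
    X 2 2 * exp (-clockInt ε M X 2) ≤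
      κ + 2 * (ε ^ 2 * exp (-M)) * exp (2 * (ε⁻¹ * M * β)) := by
  set k : ℝ := ε ^ 2 * exp (-M) * exp (2 * (ε⁻¹ * M * β)) with hk
  have hGmono := clockFloor_monotoneOn hX hM hε hb
  have hanti := Thm53.antitoneOn_sub_of_deriv_le (s := Icc (0 : ℝ) 2)
    (f := fun s => X s 2 * exp (-clockInt ε M X s)) (φ := fun _ => k) (Φ := fun u => k * u)
    (convex_Icc 0 2) (fun u _ => hasDerivAt_disc hX u)
    (fun u _ => by simpa using (hasDerivAt_id u).const_mul k) (fun u hu => by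
      have h1 := disc_deriv_le hX h0 hκ u
      have hG := hGmono (left_mem_Icc.2 (by norm_num : (0 : ℝ) ≤ 2)) hu hu.1
      simp only [clockInt_zero, mul_zero, add_zero] at hG
      -- hG : 0 ≤ G u + ε⁻¹ M β u
      have h2 : exp (-clockInt ε M X u) ≤ exp (2 * (ε⁻¹ * M * β)) := by
        apply exp_le_exp.2
        have hβ0 : 0 ≤ β := by
          have := hb 0 (left_mem_Icc.2 (by norm_num))
          rw [kick_init_b h0] at this
          linarith
        have hβ' : 0 ≤ ε⁻¹ * M * β := by positivity
        have : ε⁻¹ * M * β * u ≤ 2 * (ε⁻¹ * M * β) := by nlinarith [hu.2]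
        linarith
      calc ε ^ 2 * exp (-M) * X u 0 ^ 2 * exp (-clockInt ε M X u)
          ≤ ε ^ 2 * exp (-M) * exp (-clockInt ε M X u) := h1
        _ ≤ k := by rw [hk]; exact mul_le_mul_of_nonneg_left h2 (by positivity))
  have h := hanti (left_mem_Icc.2 (by norm_num : (0 : ℝ) ≤ 2))
    (right_mem_Icc.2 (by norm_num : (0 : ℝ) ≤ 2)) (by norm_num)
  simp only [clockInt_zero, neg_zero, exp_zero, mul_one, kick_init_c h0, mul_zero, sub_zero] at h
  rw [hk] at h
  linarith

/-- **The trap**: if `b ≥ -β` on `[0,2]` and the trigger returns to ZERO at the end of the cycle,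
`c(2) = 0`, then on the whole cycle `-ε²e^{-M}(2 - t)e^{2ε⁻¹Mβ} ≤ c(t) ≤ 0`.
[cite: Tao2016AveragedNS, §5.5 proof of Theorem 5.3] -/
theorem c_trapped (hX : ∀ t, HasDerivAt X (delayCircuitWith K M ε (X t)) t)
    (h0 : X 0 = kickInit κ) (hκ : κ ^ 2 ≤ 1) (hM : 0 ≤ M) (hε : 0 < ε) {β : ℝ}
    (hb : ∀ u ∈ Icc (0 : ℝ) 2, -β ≤ X u 1) (h2 : X 2 2 = 0) {t : ℝ} (ht : t ∈ Icc (0 : ℝ) 2) :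
    -(ε ^ 2 * exp (-M) * (2 - t) * exp (2 * (ε⁻¹ * M * β))) ≤ X t 2 ∧ X t 2 ≤ 0 := by
  have hpos : 0 < exp (-clockInt ε M X t) := exp_pos _
  constructor
  · set k : ℝ := ε ^ 2 * exp (-M) * exp (2 * (ε⁻¹ * M * β) - clockInt ε M X t) with hk
    have hGmono := clockFloor_monotoneOn hX hM hε hb
    have hanti := Thm53.antitoneOn_sub_of_deriv_le (s := Icc t 2)
      (f := fun s => X s 2 * exp (-clockInt ε M X s)) (φ := fun _ => k) (Φ := fun u => k * u)
      (convex_Icc t 2) (fun u _ => hasDerivAt_disc hX u)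
      (fun u _ => by simpa using (hasDerivAt_id u).const_mul k) (fun u hu => by
        have h1 := disc_deriv_le hX h0 hκ u
        have hu' : u ∈ Icc (0 : ℝ) 2 := ⟨ht.1.trans hu.1, hu.2⟩
        have hG := hGmono ht hu' hu.1
        simp only at hG
        -- hG : G t + c t ≤ G u + c u
        have h2 : exp (-clockInt ε M X u) ≤ exp (2 * (ε⁻¹ * M * β) - clockInt ε M X t) := by
          apply exp_le_exp.2
          have hβ0 : 0 ≤ β := by
            have hb0 := hb 0 (left_mem_Icc.2 (by norm_num))
            rw [kick_init_b h0] at hb0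
            linarith
          have hβ' : 0 ≤ ε⁻¹ * M * β := by positivity
          have : ε⁻¹ * M * β * (u - t) ≤ 2 * (ε⁻¹ * M * β) := by nlinarith [hu.1, hu.2, ht.1]
          nlinarith
        calc ε ^ 2 * exp (-M) * X u 0 ^ 2 * exp (-clockInt ε M X u)
            ≤ ε ^ 2 * exp (-M) * exp (-clockInt ε M X u) := h1
          _ ≤ k := by rw [hk]; exact mul_le_mul_of_nonneg_left h2 (by positivity))
    have h := hanti (left_mem_Icc.2 ht.2) (right_mem_Icc.2 ht.2) ht.2
    simp only [h2, zero_mul, zero_sub] at h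
    -- h : -(k * 2) ≤ X t 2 * exp (-G t) - k * t
    have h3 : -(k * (2 - t)) ≤ X t 2 * exp (-clockInt ε M X t) := by linarith
    have h4 : X t 2 = (X t 2 * exp (-clockInt ε M X t)) * exp (clockInt ε M X t) := by
      rw [mul_assoc, ← exp_add]; simp
    have h5 : -(k * (2 - t)) * exp (clockInt ε M X t) ≤ X t 2 := by
      rw [h4]; exact mul_le_mul_of_nonneg_right h3 (exp_pos _).le
    have h6 : k * exp (clockInt ε M X t) = ε ^ 2 * exp (-M) * exp (2 * (ε⁻¹ * M * β)) := by
      rw [hk, mul_assoc, ← exp_add]; congr 1; ring_nf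
    have h7 : -(k * (2 - t)) * exp (clockInt ε M X t)
        = -(ε ^ 2 * exp (-M) * (2 - t) * exp (2 * (ε⁻¹ * M * β))) := by
      have : -(k * (2 - t)) * exp (clockInt ε M X t) = -((k * exp (clockInt ε M X t)) * (2 - t)) := by
        ring
      rw [this, h6]; ring
    linarith [h5, h7.le, h7.ge]
  · have hmono := disc_monotone hX ht.2
    simp only [h2, zero_mul] at hmono
    -- hmono : X t 2 * exp (-G t) ≤ 0
    by_contra hlt
    have hlt' : 0 < X t 2 := lt_of_not_ge hlt
    have := mul_pos hlt' hpos
    linarith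

/-- **The output follows the trigger**: if `|c| ≤ C` on `[0,τ]` along a kicked trajectory
(`d(0) = ã(0) = 0`, `a² ≤ 1`) then `|d(t)|, |ã(t)| ≤ ε⁻²C·t` there — from
`∂ₜ(d² + ã²) = 2ε⁻²c·a·d` (`delayCircuitWith_out_energy`) applied to `√(d² + ã² + μ²)`.
[cite: Tao2016AveragedNS, §5.5 (dora)] -/
theorem de_le (hX : ∀ t, HasDerivAt X (delayCircuitWith K M ε (X t)) t)
    (h0 : X 0 = kickInit κ) (hκ : κ ^ 2 ≤ 1) (hε : 0 < ε) {C τ : ℝ} (hC0 : 0 ≤ C)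
    (hC : ∀ u ∈ Icc 0 τ, |X u 2| ≤ C) {t : ℝ} (ht : t ∈ Icc 0 τ) :
    |X t 3| ≤ (ε ^ 2)⁻¹ * C * t ∧ |X t 4| ≤ (ε ^ 2)⁻¹ * C * t := by
  set u : ℝ → ℝ := fun s => X s 3 ^ 2 + X s 4 ^ 2 with hu
  suffices hmain : ∀ μ : ℝ, 0 < μ → Real.sqrt (u t + μ ^ 2) ≤ μ + (ε ^ 2)⁻¹ * C * t by
    have hd : ∀ μ : ℝ, 0 < μ → |X t 3| ≤ (ε ^ 2)⁻¹ * C * t + μ := fun μ hμ => by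
      have : |X t 3| ≤ Real.sqrt (u t + μ ^ 2) :=
        abs_le_sqrt (by simp only [hu]; nlinarith [sq_nonneg (X t 4)])
      linarith [hmain μ hμ]
    have he : ∀ μ : ℝ, 0 < μ → |X t 4| ≤ (ε ^ 2)⁻¹ * C * t + μ := fun μ hμ => by
      have : |X t 4| ≤ Real.sqrt (u t + μ ^ 2) :=
        abs_le_sqrt (by simp only [hu]; nlinarith [sq_nonneg (X t 3)])
      linarith [hmain μ hμ]
    exact ⟨le_of_forall_pos_le_add fun μ hμ => hd μ hμ,
      le_of_forall_pos_le_add fun μ hμ => he μ hμ⟩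
  intro μ hμ
  set h : ℝ → ℝ := fun s => Real.sqrt (u s + μ ^ 2) with hh
  have hupos : ∀ s, 0 < u s + μ ^ 2 := fun s => by positivity
  have hder : ∀ s, HasDerivAt h
      ((2 * (ε ^ 2)⁻¹ * X s 2 * X s 0 * X s 3) / (2 * Real.sqrt (u s + μ ^ 2))) s := fun s =>
    ((delayCircuitWith_out_energy (hX s)).add_const (μ ^ 2)).sqrt (hupos s).ne'
  have hbound : ∀ s ∈ Icc 0 τ,
      (2 * (ε ^ 2)⁻¹ * X s 2 * X s 0 * X s 3) / (2 * Real.sqrt (u s + μ ^ 2)) ≤ (ε ^ 2)⁻¹ * C := by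
    intro s hs
    have hhpos : 0 < Real.sqrt (u s + μ ^ 2) := Real.sqrt_pos.2 (hupos s)
    rw [div_le_iff₀ (by positivity)]
    have hcs : |X s 2| ≤ C := hC s hs
    have ha : |X s 0| ≤ 1 := by
      have := kickW_sq_le_one hX h0 hκ s 0
      rw [← sq_abs] at this
      nlinarith [abs_nonneg (X s 0)]
    have hds : |X s 3| ≤ Real.sqrt (u s + μ ^ 2) :=
      abs_le_sqrt (by simp only [hu]; nlinarith [sq_nonneg (X s 4)])
    have h1 : |X s 2 * X s 0 * X s 3| ≤ C * Real.sqrt (u s + μ ^ 2) := by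
      rw [abs_mul, abs_mul]
      calc |X s 2| * |X s 0| * |X s 3| ≤ C * 1 * Real.sqrt (u s + μ ^ 2) :=
            mul_le_mul (mul_le_mul hcs ha (abs_nonneg _) hC0) hds (abs_nonneg _) (by positivity)
        _ = C * Real.sqrt (u s + μ ^ 2) := by ring
    have h2 : X s 2 * X s 0 * X s 3 ≤ C * Real.sqrt (u s + μ ^ 2) := (le_abs_self _).trans h1
    have h3 : 0 < (ε ^ 2)⁻¹ := by positivity
    have : 2 * (ε ^ 2)⁻¹ * X s 2 * X s 0 * X s 3 = 2 * (ε ^ 2)⁻¹ * (X s 2 * X s 0 * X s 3) := by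
      ring
    rw [this]
    nlinarith
  have hanti := Thm53.antitoneOn_sub_of_deriv_le (Φ := fun s => (ε ^ 2)⁻¹ * C * s)
    (convex_Icc 0 τ) (fun s _ => hder s)
    (fun s _ => ((hasDerivAt_id s).const_mul ((ε ^ 2)⁻¹ * C)).congr_deriv (by simp)) hbound
  have h0mem : (0 : ℝ) ∈ Icc (0 : ℝ) τ := ⟨le_rfl, ht.1.trans ht.2⟩
  have hmono := hanti h0mem ht ht.1
  have hh0 : h 0 = μ := by
    simp only [hh, hu, kick_init_d h0, kick_init_e h0]
    simp [Real.sqrt_sq hμ.le]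
  simp only [hh0, mul_zero, sub_zero] at hmono
  show h t ≤ μ + (ε ^ 2)⁻¹ * C * t
  linarith

end NegKick

/-! ## §3. The cycle-end trigger as a continuous function of the (negative) pre-load -/

open NegKick

variable {K M ε κ : ℝ} {X : ℝ → Fin 5 → ℝ}

/-- The cycle-end value `c(2)` of the member's flow line from the datum `kickInit(-κ)`.
[cite: Tao2016AveragedNS, §5.5 (5.5)–(5.6)] -/
noncomputable def cycleEndTrigger (K M ε κ : ℝ) : ℝ :=
  delayFlowWith K M ε 2 (kickInit (-κ)) 2

/-- Lipschitz dependence of the member's flow on an energy-at-most-one datum (Grönwall with the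
explicit constant `delayLipschitzWith K M ε 1` on the unit sup-ball; both flow lines stay there by
energy conservation). [cite: HairerNorsettWanner1993, Thm I.10.2] -/
theorem norm_delayFlowWith_sub_le (K M ε : ℝ) {p q : Fin 5 → ℝ} (hp : energy p ≤ 1)
    (hq : energy q ≤ 1) {t : ℝ} (ht : 0 ≤ t) :
    ‖delayFlowWith K M ε t p - delayFlowWith K M ε t q‖ ≤
      ‖p - q‖ * exp (delayLipschitzWith K M ε 1 * t) := by
  have hP : IsPseudoOrbit (delayCircuitWith K M ε) 0 1 t (fun s => delayFlowWith K M ε s p) :=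
    IsPseudoOrbit.of_hasDerivAt (hasDerivAt_delayFlowWith K M ε p) fun s _ =>
      (norm_delayFlowWith_le K M ε p s).trans (by
        simpa using Real.sqrt_le_sqrt hp)
  have hQ : IsPseudoOrbit (delayCircuitWith K M ε) 0 1 t (fun s => delayFlowWith K M ε s q) :=
    IsPseudoOrbit.of_hasDerivAt (hasDerivAt_delayFlowWith K M ε q) fun s _ =>
      (norm_delayFlowWith_le K M ε q s).trans (by
        simpa using Real.sqrt_le_sqrt hq)
  have h := IsPseudoOrbit.norm_sub_le (lipschitzOnWith_delayCircuitWith K M ε 1) hP hQ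
    (δ₀ := ‖p - q‖) (by simp [delayFlowWith_zero]) (right_mem_Icc.2 ht)
  simpa [gronwallBound_ε0] using h

/-- `κ ↦ kickInit(-κ)` is continuous. [folklore] -/
theorem continuous_kickInit_neg : Continuous fun κ : ℝ => kickInit (-κ) := by
  refine continuous_pi fun i => ?_
  fin_cases i <;> simp [kickInit] <;> fun_prop

/-- The cycle-end trigger is continuous in the pre-load on `[0,1]`. [folklore] -/
theorem continuousOn_cycleEndTrigger (K M ε : ℝ) :
    ContinuousOn (cycleEndTrigger K M ε) (Icc 0 1) := by
  rw [Metric.continuousOn_iff]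
  intro κ hκ η hη
  set L : ℝ := exp (delayLipschitzWith K M ε 1 * 2) with hL
  have hL0 : 0 < L := exp_pos _
  obtain ⟨δ, hδ0, hδ⟩ := Metric.continuous_iff.1 continuous_kickInit_neg κ (η / L) (by positivity)
  refine ⟨δ, hδ0, fun κ' hκ' hdist => ?_⟩
  have he : ∀ x ∈ Icc (0 : ℝ) 1, energy (kickInit (-x)) ≤ 1 := fun x hx => by
    rw [energy_kickInit (by nlinarith [hx.1, hx.2])]
  have h1 := norm_delayFlowWith_sub_le K M ε (he κ' hκ') (he κ hκ) (t := 2) (by norm_num)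
  have h2 : ‖kickInit (-κ') - kickInit (-κ)‖ < η / L := by
    have := hδ κ' hdist; rwa [dist_eq_norm] at this
  rw [dist_eq_norm]
  calc ‖cycleEndTrigger K M ε κ' - cycleEndTrigger K M ε κ‖
      ≤ ‖delayFlowWith K M ε 2 (kickInit (-κ')) - delayFlowWith K M ε 2 (kickInit (-κ))‖ := by
        simpa [cycleEndTrigger] using norm_le_pi_norm
          (delayFlowWith K M ε 2 (kickInit (-κ')) - delayFlowWith K M ε 2 (kickInit (-κ))) 2
    _ ≤ ‖kickInit (-κ') - kickInit (-κ)‖ * L := h1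
    _ < η / L * L := mul_lt_mul_of_pos_right h2 hL0
    _ = η := by field_simp

/-- At zero pre-load (Tao's datum (5.6)) the cycle-end trigger is non-negative. [cite: Tao2016AveragedNS, §5.5] -/
theorem cycleEndTrigger_zero_nonneg (K M ε : ℝ) : 0 ≤ cycleEndTrigger K M ε 0 := by
  have h := kickW_c_nonneg (K := K) (M := M) (ε := ε) (κ := 0)
    (X := fun s => delayFlowWith K M ε s (kickInit 0)) (hasDerivAt_delayFlowWith K M ε _)
    (delayFlowWith_zero K M ε _) le_rfl (t := 2) (by norm_num)
  simpa [cycleEndTrigger] using h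

/-! ## §4. The negative-kick dud -/

/-- The smallness used: `e^{2ε⁻¹Mβ} ≤ 11/10` for the clock floor `β = 50Mε³e^{2M}` of a trajectory
with pre-load in `[-3ε²e^{-M}, 0]`, granted `100M²ε²e^{2M} ≤ 1/20`. [folklore] -/
theorem floor_factor_le {M ε : ℝ} (hε : 0 < ε) (hsmall : 100 * M ^ 2 * ε ^ 2 * exp (2 * M) ≤ 1 / 20) :
    exp (2 * (ε⁻¹ * M * (50 * M * ε ^ 3 * exp (2 * M)))) ≤ 11 / 10 := by
  have h1 : 2 * (ε⁻¹ * M * (50 * M * ε ^ 3 * exp (2 * M))) = 100 * M ^ 2 * ε ^ 2 * exp (2 * M) := by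
    field_simp; ring
  rw [h1]
  calc exp (100 * M ^ 2 * ε ^ 2 * exp (2 * M)) ≤ exp (1 / 20) := exp_le_exp.2 hsmall
    _ ≤ 11 / 10 := by
        have h := Real.abs_exp_sub_one_sub_id_le (x := 1 / 20) (by rw [abs_le]; constructor <;> norm_num)
        have := (abs_le.1 h).2
        nlinarith

/-- The kicked datum with NEGATIVE pre-load is within sup-distance `κ` of (5.6) (`0 ≤ κ ≤ 1`).
[cite: Tao2016AveragedNS, §5.5 (5.6)] -/
theorem norm_kickInit_neg_sub_delayInit {κ : ℝ} (hκ0 : 0 ≤ κ) (hκ1 : κ ≤ 1) :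
    ‖kickInit (-κ) - delayInit‖ ≤ κ := by
  have hlow : 1 - κ ≤ Real.sqrt (1 - κ ^ 2) := by
    calc 1 - κ = Real.sqrt ((1 - κ) ^ 2) := (Real.sqrt_sq (by linarith)).symm
      _ ≤ Real.sqrt (1 - κ ^ 2) := Real.sqrt_le_sqrt (by nlinarith)
  have hup : Real.sqrt (1 - κ ^ 2) ≤ 1 := by
    simpa using Real.sqrt_le_sqrt (show 1 - κ ^ 2 ≤ 1 by nlinarith)
  rw [kickInit_sub_delayInit]
  refine (pi_norm_le_iff_of_nonneg hκ0).2 fun i => ?_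
  rw [Real.norm_eq_abs]
  fin_cases i
  · simp only [neg_sq, Fin.zero_eta, Fin.isValue, Matrix.cons_val_zero]
    rw [abs_le]; constructor <;> linarith
  · simp [hκ0]
  · simp [abs_neg, abs_of_nonneg hκ0]
  · simp [hκ0]
  · simp [hκ0]

/-- The arithmetic of the standing hypotheses used here: `K ≥ 16`, `M ≥ 4`, `ε ≤ 1`,
`3ε²e^{-M} ≤ 1/2`, `100M²ε²e^{2M} ≤ 1/20` and `e^{-M} ≤ 1/50`. [folklore] -/
theorem negKick_params (hK : 2 * 20 ^ 42 * (Nat.factorial 42 : ℝ) + 16 ≤ K)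
    (hML : 3000 * Real.log K ≤ M) (hMK : M ≤ K ^ 10) (hε : 0 < ε)
    (hεle : ε ≤ exp (-(10 * M)) / K ^ 100) :
    16 ≤ K ∧ 4 ≤ M ∧ ε ≤ 1 ∧ 3 * (ε ^ 2 * exp (-M)) ≤ 1 / 2 ∧
      100 * M ^ 2 * ε ^ 2 * exp (2 * M) ≤ 1 / 20 ∧ exp (-M) ≤ 1 / 50 := by
  obtain ⟨hK16, hM1, hε1, -⟩ := flow_params hK hML hMK hε hεle
  obtain ⟨hlog2, -, -⟩ := Thm53With.log_facts hK16
  have hM4 : 4 ≤ M := by linarith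
  have hM0 : 0 < M := by linarith
  obtain ⟨-, hε6, -, hε18⟩ := Thm53With.eps_facts hK16 hM0 hMK hε hεle
  have hK1 : (1 : ℝ) ≤ K := by linarith
  have hs : 3 * (ε ^ 2 * exp (-M)) ≤ 1 / 2 := by
    have h1 : exp (-M) ≤ 1 := by rw [exp_le_one_iff]; linarith
    have h2 : ε ^ 2 ≤ 1 / 6 := hε6.trans (by
      apply one_div_le_one_div_of_le (by norm_num)
      nlinarith [one_le_pow₀ (M₀ := ℝ) hK1 (n := 20)])
    nlinarith [sq_nonneg ε, exp_pos (-M)]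
  have hsmall : 100 * M ^ 2 * ε ^ 2 * exp (2 * M) ≤ 1 / 20 := by
    -- ε² ≤ e^{-18M}/(64M) and e^{16M} ≥ 64M² (from e^{8M} ≥ 1 + 8M ≥ 8M)
    have h8 : 8 * M ≤ exp (8 * M) := by linarith [Real.add_one_le_exp (8 * M)]
    have h16 : 64 * M ^ 2 ≤ exp (16 * M) := by
      have : exp (16 * M) = exp (8 * M) * exp (8 * M) := by rw [← exp_add]; ring_nf
      rw [this]; nlinarith [exp_pos (8 * M)]
    have hE : exp (2 * M) * exp (-(18 * M)) = (exp (16 * M))⁻¹ := by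
      rw [← exp_add, ← exp_neg]; ring_nf
    calc 100 * M ^ 2 * ε ^ 2 * exp (2 * M)
        ≤ 100 * M ^ 2 * (exp (-(18 * M)) / (64 * M)) * exp (2 * M) := by
          gcongr
      _ = 100 / 64 * M * (exp (2 * M) * exp (-(18 * M))) := by field_simp
      _ = 100 / 64 * M * (exp (16 * M))⁻¹ := by rw [hE]
      _ ≤ 100 / 64 * M * (64 * M ^ 2)⁻¹ := by
          gcongr
      _ = 100 / 64 / 64 * M⁻¹ := by field_simp
      _ ≤ 100 / 64 / 64 * 1 := by
          gcongr
          exact inv_le_one_of_one_le₀ hM1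
      _ ≤ 1 / 20 := by norm_num
  have hexpM : exp (-M) ≤ 1 / 50 := by
    have he1 := Real.exp_one_gt_d9
    have h4 : (50 : ℝ) ≤ exp 4 := by
      have : exp 4 = (exp 1) ^ 4 := by rw [← Real.exp_nat_mul]; norm_num
      rw [this]
      have h27 : (2.7 : ℝ) < exp 1 := by linarith
      have hp := pow_lt_pow_left₀ h27 (by norm_num) (by norm_num : (4 : ℕ) ≠ 0)
      norm_num at hp
      linarith
    have h5 : exp 4 ≤ exp M := exp_le_exp.2 hM4
    rw [exp_neg, inv_le_comm₀ (exp_pos M) (by norm_num)]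
    simpa using h4.trans h5
  exact ⟨hK16, hM4, hε1, hs, hsmall, hexpM⟩

/-- **Everything about one trajectory with pre-load in `[-3ε²e^{-M}, 0]`** under the standing
hypotheses: `|c| ≤ 5ε²e^{M}` and `b ≥ -50Mε³e^{2M}` on the cycle, and the cycle-end discounted
trigger is at most `-κ + (11/5)ε²e^{-M}`. [cite: Tao2016AveragedNS, §5.5] -/
theorem negKick_trajectory (hK : 2 * 20 ^ 42 * (Nat.factorial 42 : ℝ) + 16 ≤ K)
    (hML : 3000 * Real.log K ≤ M) (hMK : M ≤ K ^ 10) (hε : 0 < ε)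
    (hεle : ε ≤ exp (-(10 * M)) / K ^ 100) (hX : ∀ t, HasDerivAt X (delayCircuitWith K M ε (X t)) t)
    (h0 : X 0 = kickInit (-κ)) (hκ0 : 0 ≤ κ) (hκ3 : κ ≤ 3 * (ε ^ 2 * exp (-M))) :
    (∀ t ∈ Icc (0 : ℝ) 2, |X t 2| ≤ 5 * (ε ^ 2 * exp (-M)) * exp (2 * M)) ∧
    (∀ t ∈ Icc (0 : ℝ) 2, -(50 * M * ε ^ 3 * exp (2 * M)) ≤ X t 1) ∧
    X 2 2 * exp (-clockInt ε M X 2) ≤ -κ + 11 / 5 * (ε ^ 2 * exp (-M)) := by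
  obtain ⟨hK16, hM4, hε1, hs3, hsmall, -⟩ := negKick_params hK hML hMK hε hεle
  have hM : 0 ≤ M := by linarith
  have hκsq : (-κ) ^ 2 ≤ 1 := by rw [neg_sq]; nlinarith
  have hκneg : -κ ≤ 0 := by linarith
  have hc : ∀ t ∈ Icc (0 : ℝ) 2, |X t 2| ≤ 5 * (ε ^ 2 * exp (-M)) * exp (2 * M) := fun t ht => by
    have := abs_c_le hX h0 hκsq hκneg hM hε ht
    rw [neg_neg] at this
    refine this.trans ?_
    have : κ + 2 * (ε ^ 2 * exp (-M)) ≤ 5 * (ε ^ 2 * exp (-M)) := by linarith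
    exact mul_le_mul_of_nonneg_right this (exp_pos _).le
  have hb : ∀ t ∈ Icc (0 : ℝ) 2, -(50 * M * ε ^ 3 * exp (2 * M)) ≤ X t 1 := fun t ht => by
    have h := b_lower hX h0 hM hε hc ht
    have hC : ε⁻¹ * M * (5 * (ε ^ 2 * exp (-M)) * exp (2 * M)) ^ 2 = 25 * M * ε ^ 3 * exp (2 * M) := by
      have hE : (exp (-M) * exp (2 * M)) ^ 2 = exp (2 * M) := by
        rw [← exp_add, ← Real.exp_nat_mul]; congr 1; push_cast; ring
      have h' : (5 * (ε ^ 2 * exp (-M)) * exp (2 * M)) ^ 2 = 25 * ε ^ 4 * exp (2 * M) := by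
        rw [show 5 * (ε ^ 2 * exp (-M)) * exp (2 * M) = 5 * ε ^ 2 * (exp (-M) * exp (2 * M)) by ring,
          mul_pow, mul_pow, hE]; ring
      rw [h']; field_simp
    rw [hC] at h
    have : 0 ≤ 25 * M * ε ^ 3 * exp (2 * M) := by positivity
    nlinarith [ht.2]
  refine ⟨hc, hb, ?_⟩
  have h2 := disc_two_le hX h0 hκsq hM hε (β := 50 * M * ε ^ 3 * exp (2 * M)) (fun u hu => hb u hu)
  have hf := floor_factor_le (M := M) hε hsmall
  have hpos : 0 ≤ 2 * (ε ^ 2 * exp (-M)) := by positivity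
  nlinarith

/-- At pre-load `-3ε²e^{-M}` the trigger is NEGATIVE at the end of the cycle.
[cite: Tao2016AveragedNS, §5.5] -/
theorem cycleEndTrigger_three_seeds_neg (hK : 2 * 20 ^ 42 * (Nat.factorial 42 : ℝ) + 16 ≤ K)
    (hML : 3000 * Real.log K ≤ M) (hMK : M ≤ K ^ 10) (hε : 0 < ε)
    (hεle : ε ≤ exp (-(10 * M)) / K ^ 100) :
    cycleEndTrigger K M ε (3 * (ε ^ 2 * exp (-M))) < 0 := by
  set X : ℝ → Fin 5 → ℝ := fun s => delayFlowWith K M ε s (kickInit (-(3 * (ε ^ 2 * exp (-M)))))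
  obtain ⟨-, -, h2⟩ := negKick_trajectory (X := X) hK hML hMK hε hεle
    (hasDerivAt_delayFlowWith K M ε _) (delayFlowWith_zero K M ε _) (by positivity) le_rfl
  have hs : 0 < ε ^ 2 * exp (-M) := by positivity
  have hneg : X 2 2 * exp (-clockInt ε M X 2) < 0 := by nlinarith
  have hpos : 0 < exp (-clockInt ε M X 2) := exp_pos _
  have : X 2 2 < 0 := by
    by_contra h
    have h' : 0 ≤ X 2 2 := le_of_not_gt h
    nlinarith [mul_nonneg h' hpos.le]
  simpa [cycleEndTrigger, X] using this

/-- **The negative-kick dud.** Under the standing hypotheses of the family's Theorem 5.3 there is a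
pre-load `κ* ∈ (0, 3ε²e^{-M})` — fewer than three seeds, NEGATIVE — such that the EXACT flow line of
`delayCircuitWith K M ε` from `kickInit(-κ*) = (√(1-κ*²), 0, -κ*, 0, 0)` returns its trigger to
zero exactly at the end of the cycle, `c(2) = 0`, keeps `-3ε²e^{-M} ≤ c ≤ 0` on the whole cycle
`[0,2]`, and therefore never drives the rotor: `|d|, |ã| ≤ 6e^{-M}` on `[0,2]` — the gate does NOT
fire on its cycle (Tao's member fires with `|ã(2) - 1| ≤ 200K⁻¹⁰`). [cite: Tao2016AveragedNS, Theorem 5.3] -/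
theorem exists_negativeKick_dud (hK : 2 * 20 ^ 42 * (Nat.factorial 42 : ℝ) + 16 ≤ K)
    (hML : 3000 * Real.log K ≤ M) (hMK : M ≤ K ^ 10) (hε : 0 < ε)
    (hεle : ε ≤ exp (-(10 * M)) / K ^ 100) :
    ∃ κ : ℝ, 0 < κ ∧ κ < 3 * (ε ^ 2 * exp (-M)) ∧
      delayFlowWith K M ε 2 (kickInit (-κ)) 2 = 0 ∧
      ∀ t ∈ Icc (0 : ℝ) 2,
        delayFlowWith K M ε t (kickInit (-κ)) 2 ≤ 0 ∧
        -(3 * (ε ^ 2 * exp (-M))) ≤ delayFlowWith K M ε t (kickInit (-κ)) 2 ∧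
        |delayFlowWith K M ε t (kickInit (-κ)) 3| ≤ 6 * exp (-M) ∧
        |delayFlowWith K M ε t (kickInit (-κ)) 4| ≤ 6 * exp (-M) := by
  obtain ⟨hK16, hM4, hε1, hs3, hsmall, hexpM⟩ := negKick_params hK hML hMK hε hεle
  have hM : 0 ≤ M := by linarith
  have hs : 0 < ε ^ 2 * exp (-M) := by positivity
  set s₃ : ℝ := 3 * (ε ^ 2 * exp (-M)) with hs₃
  -- IVT on [0, 3s]
  have hcont : ContinuousOn (cycleEndTrigger K M ε) (Icc 0 s₃) :=
    (continuousOn_cycleEndTrigger K M ε).mono (Icc_subset_Icc le_rfl (by linarith))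
  have hIVT := intermediate_value_Icc' (show (0 : ℝ) ≤ s₃ by positivity) hcont
  have h0 : 0 ≤ cycleEndTrigger K M ε 0 := cycleEndTrigger_zero_nonneg K M ε
  have h3 : cycleEndTrigger K M ε s₃ < 0 := cycleEndTrigger_three_seeds_neg hK hML hMK hε hεle
  obtain ⟨κ, ⟨hκ0, hκ3⟩, hroot⟩ := hIVT ⟨h3.le, h0⟩
  -- the trajectory at the root
  set X : ℝ → Fin 5 → ℝ := fun σ => delayFlowWith K M ε σ (kickInit (-κ)) with hXdef
  have hX : ∀ t, HasDerivAt X (delayCircuitWith K M ε (X t)) t := hasDerivAt_delayFlowWith K M ε _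
  have hX0 : X 0 = kickInit (-κ) := delayFlowWith_zero K M ε _
  have hκsq : (-κ) ^ 2 ≤ 1 := by rw [neg_sq]; nlinarith
  obtain ⟨hc5, hb, -⟩ := negKick_trajectory hK hML hMK hε hεle hX hX0 hκ0 hκ3
  have h2 : X 2 2 = 0 := by simpa [cycleEndTrigger, hXdef] using hroot
  have hf := floor_factor_le (M := M) hε hsmall
  have htrap : ∀ t ∈ Icc (0 : ℝ) 2, X t 2 ≤ 0 ∧ -s₃ ≤ X t 2 := fun t ht => by
    obtain ⟨hl, hu⟩ := c_trapped hX hX0 hκsq hM hε (β := 50 * M * ε ^ 3 * exp (2 * M)) hb h2 ht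
    refine ⟨hu, le_trans ?_ hl⟩
    have h22 : ε ^ 2 * exp (-M) * (2 - t) * exp (2 * (ε⁻¹ * M * (50 * M * ε ^ 3 * exp (2 * M))))
        ≤ ε ^ 2 * exp (-M) * 2 * (11 / 10) := by
      have ha : ε ^ 2 * exp (-M) * (2 - t) ≤ ε ^ 2 * exp (-M) * 2 := by nlinarith [ht.1]
      exact mul_le_mul ha hf (exp_pos _).le (by positivity)
    rw [hs₃]; linarith
  have habs : ∀ t ∈ Icc (0 : ℝ) 2, |X t 2| ≤ s₃ := fun t ht => by
    obtain ⟨hu, hl⟩ := htrap t ht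
    rw [abs_le]; exact ⟨hl, by linarith⟩
  have hde : ∀ t ∈ Icc (0 : ℝ) 2, |X t 3| ≤ 6 * exp (-M) ∧ |X t 4| ≤ 6 * exp (-M) := fun t ht => by
    obtain ⟨hd, he⟩ := de_le hX hX0 hκsq hε (by positivity) habs ht
    have hC : (ε ^ 2)⁻¹ * s₃ * t ≤ 6 * exp (-M) := by
      have : (ε ^ 2)⁻¹ * s₃ = 3 * exp (-M) := by rw [hs₃]; field_simp
      rw [this]; nlinarith [ht.2, exp_pos (-M)]
    exact ⟨hd.trans hC, he.trans hC⟩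
  -- κ > 0: at κ = 0 the member fires (Theorem 5.3 for the family), contradicting |ã(2)| ≤ 6e^{-M}
  have hκpos : 0 < κ := by
    rcases hκ0.lt_or_eq with h | h
    · exact h
    · exfalso
      have hK0 : 0 < K := by linarith
      have hfire := (delayFlowWith_kickInit_fires hK hML hMK hε hεle le_rfl
        (kickToleranceWith_pos hK0 hε).le (σ := 2) le_rfl).1
      have hdud := (hde 2 (right_mem_Icc.2 (by norm_num))).2
      have hX2 : X 2 4 = delayFlowWith K M ε 2 (kickInit 0) 4 := by simp [hXdef, ← h]
      rw [hX2] at hdud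
      have hK10 : 200 / K ^ 10 ≤ 1 / 4 := by
        rw [div_le_iff₀ (by positivity)]
        have : (16 : ℝ) ^ 10 ≤ K ^ 10 := pow_le_pow_left₀ (by norm_num) hK16 10
        nlinarith
      have h1 := (abs_sub_le_iff.1 hfire).2
      have h2 := (abs_le.1 hdud).2
      linarith
  have hκlt : κ < s₃ := by
    rcases hκ3.lt_or_eq with h | h
    · exact h
    · exfalso; rw [h] at hroot; linarith
  refine ⟨κ, hκpos, hκlt, h2, fun t ht => ⟨(htrap t ht).1, (htrap t ht).2, hde t ht⟩⟩

/-! ## §5. Consequences: the trigger channel is asymmetric; no datum radius of three seeds -/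

/-- **The trigger channel of the gate is ASYMMETRIC.** Every positive pre-load up to
`kickToleranceWith K M ε = ε²e^{-M}K¹⁰` (K¹⁰ seeds) fires on time (`|ã(σ) - 1| ≤ 200K⁻¹⁰` for all
`σ ≥ 2`, TriggerToleranceWith), while SOME negative pre-load of fewer than three seeds keeps the
output `≤ 6e^{-M}` on the whole cycle `[0,2]`. [cite: Tao2016AveragedNS, Theorem 5.3] -/
theorem trigger_channel_asymmetric (hK : 2 * 20 ^ 42 * (Nat.factorial 42 : ℝ) + 16 ≤ K)
    (hML : 3000 * Real.log K ≤ M) (hMK : M ≤ K ^ 10) (hε : 0 < ε)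
    (hεle : ε ≤ exp (-(10 * M)) / K ^ 100) :
    (∀ κ ∈ Icc 0 (kickToleranceWith K M ε), ∀ σ, 2 ≤ σ →
        |delayFlowWith K M ε σ (kickInit κ) 4 - 1| ≤ 200 / K ^ 10) ∧
    ∃ κ : ℝ, 0 < κ ∧ κ < 3 * (ε ^ 2 * exp (-M)) ∧
      ∀ t ∈ Icc (0 : ℝ) 2, |delayFlowWith K M ε t (kickInit (-κ)) 4| ≤ 6 * exp (-M) := by
  refine ⟨fun κ hκ σ hσ => (delayFlowWith_kickInit_fires hK hML hMK hε hεle hκ.1 hκ.2 hσ).1, ?_⟩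
  obtain ⟨κ, hκ0, hκ3, -, h⟩ := exists_negativeKick_dud hK hML hMK hε hεle
  exact ⟨κ, hκ0, hκ3, fun t ht => (h t ht).2.2.2⟩

/-- **No datum radius of three seeds.** If every energy-one datum within sup-distance `r` of (5.6)
is guaranteed to have fired by the end of the cycle (`|ã(2) - 1| ≤ 1/2` along the member's flow),
then `r < 3ε²e^{-M}`: the datum-robustness radius of the gate is below three seeds, although in the
positive trigger direction alone it is at least `ε²e^{-M}K¹⁰`. No forcing is involved.
[cite: Tao2016AveragedNS, Theorem 5.3] -/
theorem datum_radius_lt_three_seeds (hK : 2 * 20 ^ 42 * (Nat.factorial 42 : ℝ) + 16 ≤ K)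
    (hML : 3000 * Real.log K ≤ M) (hMK : M ≤ K ^ 10) (hε : 0 < ε)
    (hεle : ε ≤ exp (-(10 * M)) / K ^ 100) {r : ℝ}
    (h : ∀ p : Fin 5 → ℝ, energy p = 1 → ‖p - delayInit‖ ≤ r →
      |delayFlowWith K M ε 2 p 4 - 1| ≤ 1 / 2) :
    r < 3 * (ε ^ 2 * exp (-M)) := by
  obtain ⟨-, -, -, hs3, -, hexpM⟩ := negKick_params hK hML hMK hε hεle
  obtain ⟨κ, hκ0, hκ3, -, hdud⟩ := exists_negativeKick_dud hK hML hMK hε hεle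
  by_contra hr
  have hr' : 3 * (ε ^ 2 * exp (-M)) ≤ r := le_of_not_gt hr
  have hκ1 : κ ≤ 1 := by linarith
  have hen : energy (kickInit (-κ)) = 1 := energy_kickInit (by rw [neg_sq]; nlinarith)
  have hnorm : ‖kickInit (-κ) - delayInit‖ ≤ r :=
    (norm_kickInit_neg_sub_delayInit hκ0.le hκ1).trans (by linarith)
  have hfire := h _ hen hnorm
  have hq := (hdud 2 (right_mem_Icc.2 (by norm_num))).2.2.2
  have h1 := (abs_sub_le_iff.1 hfire).2
  have h2 := (abs_le.1 hq).2
  linarith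

end Literature.Analysis.FluidPDE.Tao2016AveragedNS
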